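import Literature.AlgebraicGeometry.HodgeTheory.CyclicCoverPencilShellInvariance
import HarnessLib

/-!
# The solved coefficient vector along the nodal pencil: `b(b'₀, y) = b₀ − φ(y)·e_{x₂^p}`

Family `hodge`, layer `Literature/AlgebraicGeometry/HodgeTheory`; a one-line consequence of `CyclicCoverPencilChartPartial`
(`regChartCoeffVec_nodalPencil_regPowIndex`: the solved coefficient is `−φ(y)`) and `CyclicCoverPencilShellInvariance.coeffsOf_nodal_regPowIndex`
(`(b₀)_{x₂^p} = 0`): with `b₀ = coeffs(x₃^p − f₁)` and `b'₀` its restriction off `x₂^p`, the full solved coefficient vector at chart coordinates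
`(b'₀, y)` is `b₀ − φ(y)·e_{x₂^p}`, `φ(y) = y₂^p − (y₀y₁ + y₀^p + y₁^p)`. In particular its pencil coordinate is `φ(y)`; after the model rotation
`y ↦ Θ⁻¹R_θΘy` it becomes `e^{iθ}φ(y)` — the nonsingularity hypothesis of `CyclicCoverPencilModelIsotopy.chartModelIsotopy_mem_and_apply` is thus a
statement about the pencil member `x₃^p = f₁ + e^{iθ}φ(y)·x₂^p`.

* `regChartCoeffVec_nodalPencil_eq` — the identity.

Everything is proved; no definitions, no named facts.

## References

* [CarlsonToledo1999] J. A. Carlson, D. Toledo, Duke Math. J. 97 (1999), §6 (kdoublept).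
-/

noncomputable section

open MvPolynomial Set Function
open Literature.AlgebraicGeometry.Motives Literature.AlgebraicGeometry.Motives.UniversalHypersurface
open Literature.AlgebraicGeometry.HodgeTheory.UniversalHypersurface

namespace Literature.AlgebraicGeometry.HodgeTheory

variable (p : ℕ)

/-- **`b(b'₀, y) = b₀ − φ(y)·e_{x₂^p}`** for the nodal pencil (`p ≥ 3`). [cite: CarlsonToledo1999, §6 (kdoublept)] -/
theorem regChartCoeffVec_nodalPencil_eq (hp : 3 ≤ p) (y : Fin (2 + 1) → ℂ) :
    regChartCoeffVec 2 p 2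
        (Sum.elim (fun m : {m : DegIndex 2 p // m ≠ regPowIndex 2 p 2} =>
          coeffsOf 2 p (cyclicCoverForm p (X 2 ^ (p - 2) * (X 0 * X 1) + X 0 ^ p + X 1 ^ p)) m.1) y) =
      coeffsOf 2 p (cyclicCoverForm p (X 2 ^ (p - 2) * (X 0 * X 1) + X 0 ^ p + X 1 ^ p)) -
        Pi.single (regPowIndex 2 p 2) (y 2 ^ p - (y 0 * y 1 + y 0 ^ p + y 1 ^ p)) := by
  funext m
  by_cases hm : m = regPowIndex 2 p 2
  · subst hm
    rw [regChartCoeffVec_nodalPencil_regPowIndex p hp y, Pi.sub_apply, Pi.single_eq_same, coeffsOf_nodal_regPowIndex p hp]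
    ring
  · rw [regChartCoeffVec_of_ne 2 p 2 _ hm, Pi.sub_apply, Pi.single_eq_of_ne hm, sub_zero]
    rfl

/-- **Hence the pencil coordinate of a chart point with `b' = b'₀` and affine coordinates `y` is `φ(y)`, and the coefficient vector is
`b₀ − c·e_{x₂^p}` with `c = pencilCoord`** — restated for points: `b(Q) = b₀ − pencilCoord(Q)·e_{x₂^p}`. [cite: CarlsonToledo1999, §6 (kdoublept)] -/
theorem regCoeff_eq_sub_single_pencilCoord (hp : 3 ≤ p) {Q : ComplexPoints (regularTotal ℂ 2 p)}
    (hb : ∀ m : {m : DegIndex 2 p // m ≠ regPowIndex 2 p 2},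
      regCoeff ℂ 2 p Q m.1 = coeffsOf 2 p (cyclicCoverForm p (X 2 ^ (p - 2) * (X 0 * X 1) + X 0 ^ p + X 1 ^ p)) m.1) :
    regCoeff ℂ 2 p Q =
      coeffsOf 2 p (cyclicCoverForm p (X 2 ^ (p - 2) * (X 0 * X 1) + X 0 ^ p + X 1 ^ p)) -
        Pi.single (regPowIndex 2 p 2) (pencilCoord p Q) := by
  funext m
  by_cases hm : m = regPowIndex 2 p 2
  · subst hm
    rw [Pi.sub_apply, Pi.single_eq_same, coeffsOf_nodal_regPowIndex p hp, pencilCoord]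
    ring
  · rw [Pi.sub_apply, Pi.single_eq_of_ne hm, sub_zero]
    exact hb ⟨m, hm⟩

end Literature.AlgebraicGeometry.HodgeTheory

end
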